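import Mathlib
import HarnessLib
import Summits.ResolutionOfSingularities.ResolutionOfSingularities.Theorems.WildQuotientsWildQuotientResolutionS1aChartRingGrading
import Summits.ResolutionOfSingularities.ResolutionOfSingularities.Theorems.WildQuotientsWildQuotientResolutionS1aWeightedReesRegular
import Literature.AlgebraicGeometry.Resolution.RegularCentreLocal

/-!
# S1a — the chart ring `R^w[(b T^d)⁻¹]` as a NODE: Noetherian, regular, units (T1), generation (T2)

[OURS · L1 W4.5c · lead-1 g6] — NOT a statement of the manuscript; counted 0; AI-level work, weaker than expert
review. Crux stmt-ResolutionOfSingularities-17941 (`WildQuotients.CyclicQuotientFourfolds`), line `s1a-logminvertex`,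
stub `stub_localGame` (producer): four of the six conjuncts of H3 `IsTameNode p (ChartRing …) 𝒜ʼ σʼ`
(`…S1aProducerStep`, p572348) for the chart ring of H4a with ITS Rees bigrading `𝒜ʼ = chartGrading` of
`…S1aChartRingGrading`; the remaining two (the graded automorphism `σʼ` of order `p` extending `σ ⊗ id_T`) are the
next file.

* `chartRing_isNoetherianRing_isRegularRing` — under K1′ (`f` a `B`-regular sequence, `B ⧸ (f)` regular, `0 < wᵢ`) on
  a regular `B`: H3a `cobordantAlgebra_isRegularRing_of_isRegular` (stub-1, p567753; on Literature
  `cobordantAlgebra.isRegularRing`, [cite: Wlodarczyk2022, §2.3.9]) + Literature `isRegularRing_of_isLocalization`;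
* `chartRing_T2` — (T2) for the node `B` ⇒ (T2) for the chart ring: generators = images of the old generators, the
  `fᵢ T^{wᵢ}`, `T⁻¹`, and `h⁻¹`;
* `chartRing_T1` — (T1) for `B` ⇒ (T1) for the chart ring: the old homogeneous units (bidegrees `(0, e)`) and the new
  unit `h` (bidegree `(d, 0)`, `0 < d`); the degrees generate a subgroup containing `dℤ × ⟨s⟩`, of finite index.
-/

set_option linter.dupNamespace false

noncomputable section

open DirectSum Literature.AlgebraicGeometry.Resolution
open scoped LaurentPolynomial
open Summit.ResolutionOfSingularities.ResolutionOfSingularities.Theorems.WildQuotientResolution.S1.GradedLocalization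
open Summit.ResolutionOfSingularities.ResolutionOfSingularities.Theorems.WildQuotientResolution.S1.ReesBigrading

namespace Summit.ResolutionOfSingularities.ResolutionOfSingularities.Theorems.WildQuotientResolution.S1.CoarseChart

universe u v

variable {ι : Type v} [AddCommGroup ι] [DecidableEq ι] {B : Type u} [CommRing B]
  (𝒜 : ι → AddSubgroup B) [GradedRing 𝒜] {c : ℕ} (f : Fin c → B) {δ : Fin c → ι} (w : Fin c → ℕ)
  (hf : ∀ i, f i ∈ 𝒜 (δ i)) (d : ℕ) (b : ↥(𝒜 0)) (hb : b ∈ (traceFiltration 𝒜 f w).ideal d)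

/-! ## Noetherian and regular -/

/-- **The chart ring of a K1′-regular centre on a regular ring is Noetherian and regular.** [OURS · L1 W4.5c] -/
theorem chartRing_isNoetherianRing_isRegularRing [IsRegularRing B] (hw : ∀ i, 0 < w i)
    (hK1 : RingTheory.Sequence.IsRegular B (List.ofFn f))
    (hK1' : IsRegularRing (B ⧸ Ideal.span (Set.range f))) :
    IsNoetherianRing (ChartRing 𝒜 f w d b hb) ∧ IsRegularRing (ChartRing 𝒜 f w d b hb) := by
  obtain ⟨hN, hR⟩ := cobordantAlgebra_isRegularRing_of_isRegular f w hw hK1 hK1'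
  haveI := hN
  haveI := hR
  exact ⟨IsLocalization.isNoetherianRing (Submonoid.powers (coverElement 𝒜 f w d b hb)) _ hN,
    isRegularRing_of_isLocalization (Submonoid.powers (coverElement 𝒜 f w d b hb)) _⟩

/-! ## (T2) finite generation over the degree-0 part -/

/-- The structure map `B → R^w[h⁻¹]`. -/
def ofBase : B →+* ChartRing 𝒜 f w d b hb :=
  (algebraMap (↥(cobordantAlgebra f w)) (ChartRing 𝒜 f w d b hb)).comp (algebraMap B (↥(cobordantAlgebra f w)))

/-- Degree-`0` elements of `B` land in bidegree `0` of the chart ring. -/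
theorem ofBase_mem_chartGrading_zero {x : B} (hx : x ∈ 𝒜 0) :
    ofBase 𝒜 f w d b hb x ∈ chartGrading 𝒜 f w hf d b hb 0 :=
  algebraMap_mem_chartGrading 𝒜 f w hf d b hb (algebraMap_mem_reesPiece 𝒜 f w hx)

/-- **(T2) for the chart ring.** [OURS · L1 W4.5c] -/
theorem chartRing_T2 (hT2 : ∃ t : Finset B, Subring.closure (((𝒜 0 : AddSubgroup B) : Set B) ∪ ↑t) = ⊤) :
    ∃ t' : Finset (ChartRing 𝒜 f w d b hb),
      Subring.closure (((chartGrading 𝒜 f w hf d b hb 0 : AddSubgroup (ChartRing 𝒜 f w d b hb)) :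
        Set (ChartRing 𝒜 f w d b hb)) ∪ ↑t') = ⊤ := by
  classical
  obtain ⟨t, ht⟩ := hT2
  let φ := ofBase 𝒜 f w d b hb
  let ψ := algebraMap (↥(cobordantAlgebra f w)) (ChartRing 𝒜 f w d b hb)
  let t' : Finset (ChartRing 𝒜 f w d b hb) :=
    t.image φ ∪ Finset.univ.image (fun i => ψ (cobordantAlgebra.u' f w i)) ∪
      {ψ (cobordantAlgebra.s f w), IsLocalization.Away.invSelf (coverElement 𝒜 f w d b hb)}
  refine ⟨t', ?_⟩
  set C := Subring.closure (((chartGrading 𝒜 f w hf d b hb 0 : AddSubgroup (ChartRing 𝒜 f w d b hb)) :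
    Set (ChartRing 𝒜 f w d b hb)) ∪ ↑t') with hC
  have ht' : ∀ y ∈ t', y ∈ C := fun y hy => Subring.subset_closure (Or.inr hy)
  -- (a) the base ring `B` maps into `C`
  have hB : ∀ x : B, φ x ∈ C := by
    intro x
    have hx : x ∈ Subring.closure (((𝒜 0 : AddSubgroup B) : Set B) ∪ ↑t) := by rw [ht]; trivial
    have hmap : (Subring.closure (((𝒜 0 : AddSubgroup B) : Set B) ∪ ↑t)).map φ ≤ C := by
      rw [RingHom.map_closure, Subring.closure_le]
      rintro _ ⟨y, hy | hy, rfl⟩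
      · exact Subring.subset_closure (Or.inl (ofBase_mem_chartGrading_zero 𝒜 f w hf d b hb hy))
      · exact ht' _ (by simp [t', Finset.mem_image_of_mem _ (Finset.mem_coe.mp hy)])
    exact hmap ⟨x, hx, rfl⟩
  -- (b) the cobordant algebra maps into `C`
  have hR : ∀ z : ↥(cobordantAlgebra f w), ψ z ∈ C := by
    rintro ⟨z, hz⟩
    refine Algebra.adjoin_induction (p := fun x hx => ψ ⟨x, hx⟩ ∈ C) ?_ ?_ ?_ ?_ hz
    · rintro x (rfl | ⟨i, rfl⟩)
      · have : (⟨_, Algebra.subset_adjoin (Set.mem_insert _ _)⟩ : ↥(cobordantAlgebra f w)) =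
            cobordantAlgebra.s f w := Subtype.ext rfl
        rw [this]
        exact ht' _ (by simp [t'])
      · have : (⟨_, Algebra.subset_adjoin (Set.mem_insert_of_mem _ ⟨i, rfl⟩)⟩ : ↥(cobordantAlgebra f w)) =
            cobordantAlgebra.u' f w i := Subtype.ext rfl
        rw [this]
        exact ht' _ (by simp [t'])
    · intro r
      have : (⟨algebraMap B B[T;T⁻¹] r, Subalgebra.algebraMap_mem _ r⟩ : ↥(cobordantAlgebra f w)) =
          algebraMap B (↥(cobordantAlgebra f w)) r := Subtype.ext rfl
      rw [this]
      exact hB r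
    · intro x y hx hy hpx hpy
      have : (⟨x + y, add_mem hx hy⟩ : ↥(cobordantAlgebra f w)) = ⟨x, hx⟩ + ⟨y, hy⟩ := rfl
      rw [this, map_add]
      exact add_mem hpx hpy
    · intro x y hx hy hpx hpy
      have : (⟨x * y, mul_mem hx hy⟩ : ↥(cobordantAlgebra f w)) = ⟨x, hx⟩ * ⟨y, hy⟩ := rfl
      rw [this, map_mul]
      exact mul_mem hpx hpy
  -- (c) every fraction `z / hᵐ`
  rw [eq_top_iff]
  rintro y -
  obtain ⟨z, m, rfl⟩ := exists_eq_algebraMap_mul_invSelf_pow (h := coverElement 𝒜 f w d b hb) y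
  exact mul_mem (hR z) (pow_mem (ht' _ (by simp [t'])) m)

/-! ## (T1) homogeneous units with degrees of finite index -/

/-- `dℤ × ⟨s⟩ ≤ ⟨(d, 0), (0, s)⟩` in `ℤ × ι`. -/
theorem prod_le_closure (s : Finset ι) :
    (AddSubgroup.zmultiples (d : ℤ)).prod (AddSubgroup.closure (s : Set ι)) ≤
      AddSubgroup.closure (↑(insert ((d : ℤ), (0 : ι)) (s.image fun i => ((0 : ℤ), i))) :
        Set (ℤ × ι)) := by
  classical
  rintro ⟨a, i⟩ ⟨ha, hi⟩
  have hsplit : ((a, i) : ℤ × ι) = (a, 0) + (0, i) := by simp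
  rw [hsplit]
  refine add_mem ?_ ?_
  · obtain ⟨k, rfl⟩ := AddSubgroup.mem_zmultiples_iff.mp ha
    have : ((k • (d : ℤ), (0 : ι)) : ℤ × ι) = k • ((d : ℤ), (0 : ι)) := by simp
    rw [this]
    exact AddSubgroup.zsmul_mem _ (AddSubgroup.subset_closure (Finset.mem_coe.mpr (Finset.mem_insert_self _ _))) k
  · have hmap : (AddSubgroup.closure (s : Set ι)).map (AddMonoidHom.inr ℤ ι) ≤
        AddSubgroup.closure (↑(insert ((d : ℤ), (0 : ι)) (s.image fun i => ((0 : ℤ), i))) : Set (ℤ × ι)) := by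
      rw [AddMonoidHom.map_closure, AddSubgroup.closure_le]
      rintro _ ⟨j, hj, rfl⟩
      refine AddSubgroup.subset_closure (Finset.mem_coe.mpr (Finset.mem_insert_of_mem ?_))
      exact Finset.mem_image.mpr ⟨j, hj, rfl⟩
    exact hmap ⟨i, hi, rfl⟩

/-- **(T1) for the chart ring** (`0 < d`). [OURS · L1 W4.5c] -/
theorem chartRing_T1 (hd : 0 < d)
    (hT1 : ∃ s : Finset ι, (∀ e ∈ s, ∃ u : B, IsUnit u ∧ u ∈ 𝒜 e) ∧
      (AddSubgroup.closure (s : Set ι)).FiniteIndex) :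
    ∃ s' : Finset (ℤ × ι), (∀ e ∈ s', ∃ u : ChartRing 𝒜 f w d b hb, IsUnit u ∧ u ∈ chartGrading 𝒜 f w hf d b hb e) ∧
      (AddSubgroup.closure (s' : Set (ℤ × ι))).FiniteIndex := by
  classical
  obtain ⟨s, hs, hfin⟩ := hT1
  refine ⟨insert ((d : ℤ), (0 : ι)) (s.image fun i => ((0 : ℤ), i)), ?_, ?_⟩
  · intro e he
    rcases Finset.mem_insert.mp he with rfl | he
    · -- the new unit `h = b T^d`
      exact ⟨algebraMap _ (ChartRing 𝒜 f w d b hb) (coverElement 𝒜 f w d b hb),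
        IsLocalization.Away.algebraMap_isUnit _,
        algebraMap_mem_chartGrading 𝒜 f w hf d b hb (coverElement_mem_reesPiece 𝒜 f w d b hb)⟩
    · obtain ⟨i, hi, rfl⟩ := Finset.mem_image.mp he
      obtain ⟨u, hu, hui⟩ := hs i hi
      exact ⟨ofBase 𝒜 f w d b hb u, hu.map _,
        algebraMap_mem_chartGrading 𝒜 f w hf d b hb (algebraMap_mem_reesPiece 𝒜 f w hui)⟩
  · haveI := hfin
    haveI hz : (AddSubgroup.zmultiples (d : ℤ)).FiniteIndex := by
      refine ⟨?_⟩
      rw [Int.index_zmultiples]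
      simp [Nat.pos_iff_ne_zero.mp hd]
    haveI : ((AddSubgroup.zmultiples (d : ℤ)).prod (AddSubgroup.closure (s : Set ι))).FiniteIndex := by
      rw [AddSubgroup.finiteIndex_iff, AddSubgroup.index_prod]
      exact mul_ne_zero (AddSubgroup.finiteIndex_iff.mp hz) (AddSubgroup.finiteIndex_iff.mp hfin)
    exact AddSubgroup.finiteIndex_of_le (prod_le_closure d s)

end Summit.ResolutionOfSingularities.ResolutionOfSingularities.Theorems.WildQuotientResolution.S1.CoarseChart

end
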